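import Literature.AnabelianGeometry.EtaleTheta.ThetaRootOrbits
import Literature.AnabelianGeometry.EtaleTheta.RigidOfSetting
import Literature.AnabelianGeometry.EtaleTheta.DoubleUnderlineTower
import HarnessLib

/-!
# [EtTh] §2 Def 2.7 / Cor 2.8 at the §1 MODEL: the orbit data `ThetaOrbitData` of the `l`-th roots of the
# étale theta class, constructed from the §1 objects along an embedding `Π^tp_X ↪ Π^tp_C`

Mochizuki, *The Étale Theta Function …* [EtTh], Publ. RIMS 45 (2009), §2, PRIMS PDF pp.40–42
(locators `p.N` = PDF pages; bib key `MochizukiEtTh2009`): "η̈^{Θ,ℤ×μ₂} … η̈^{Θ,l·ℤ×μ₂}, η̲̈^{Θ,l·ℤ×μ₂} …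
η̈^{Θ,l·ℤ}, η̲̈^{Θ,l·ℤ}" (p.41), "upon restriction to `Ÿ̲̲`, `η̈^Θ` determines `η̲̈^Θ ∈ H¹(Π^tp_{Ÿ̲̲}, l·Δ_Θ)`"
(p.41), "the decomposition groups of the points … lying over `τ^{±1}`" (Def 1.9, p.29).

Cell abc-iut, layer L2, merge row W3-L2-02 «§2 COVER/ORBIT MODEL», file 2 (seat abc-iut-L2-t2, owner of
`ThetaRootOrbits.lean`; L2-lead RULINGS #4 (R38)). The interface `ThetaCovers.ThetaOrbitData T`
(`ThetaRootOrbits.lean`) lives over abc-iut-L2-t2's `ThetaCovers.TemperedCoverData T` (the tempered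
`Π^tp_C = T.Gtp` with its coverings), whose constructor at the §1 model `TemperedCoverData.ofSetting` is
abc-iut-L2-d3's (census `W3-L2-02-CENSUS.md` §3; it needs the profinite `Π_C`-package `PiCData` and the
repaired `ThetaCovers.lean`). THIS file is the ORBIT layer, DECOUPLED from that constructor: for ANY
`T : TemperedCoverData l` and ANY choice `C : E.DoubleUnderline l` of `X̲̲` over a theta setting `D` with
étale theta data `E` (seats abc-iut-L2-t1 / abc-iut-L2-t8), a PARAMETER BUNDLE
`DoubleUnderline.OrbitEmbedding C T` (ruling η′: parameters, never named facts) records how `Π^tp_X` sits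
in `T.Gtp` — an injective homomorphism `ι` (d3: `MuTwoSetting.inclX`) with `ι(Π^tp_Ÿ) = T.PiYddtp`,
`ι(Π^tp_{X̲̲}) = Π^tp_{X̲̲}` of `T`, normality IN `Π^tp_C` of `ι(toTheta⁻¹ Δ_Θ)` and `ι(Ker toTheta)`, the
identification `G_K ≃ T.GK` compatible with the augmentations, and the two non-cuspidal points `τ^{±1}`
of Def 1.9 (abc-iut-L2-t1's `NonCuspidalPoint`) — and `ThetaOrbitData.ofEmbedding` builds the orbit
data: the cyclotome as the subquotient `ι(toTheta⁻¹ Δ_Θ)/ι(Ker toTheta)` of `Π^tp_C`; `Dtau` = the images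
of `D_{τ^{±1}} ∩ Π^tp_{X̲̲}`; the collections `η̈^{Θ,ℤ×μ₂} ⊇ η̈^{Θ,l·ℤ×μ₂} ⊇ η̈^{Θ,l·ℤ}` = TRANSPORTS of the
`Π^tp_X`-, `Π^tp_{X̲}`-, `(Π^tp_{X̲} ∩ ι⁻¹Π^tp_Ċ)`-orbits of abc-iut-L2-t1's class `η̈^Θ = E.etaDd`
(`ThetaCohomology`/`ContH1`: a class is carried as its SET of cocycle representatives, transported
pointwise), and `η̲̈^{Θ,l·ℤ×μ₂} ⊇ η̲̈^{Θ,l·ℤ}` = the classes of `l`-th ROOTS on `Π^tp_{Ÿ̲̲}` of the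
`Π^tp_{X̲̲}`-, `(Π^tp_{X̲̲} ∩ ι⁻¹Π^tp_Ċ)`-orbits. READING (as in abc-iut-L2-t8's `DoubleUnderline.rootCocycles`,
`ThetaEnvOfSetting.lean`): a root class collects ALL `l`-th roots of all representatives — the union of
the (at most `l`) translates that Cor 2.8 (i) (p.42) says are only determined "up to multiplication by a
root of unity of order `l`"; so `root_pow` holds by construction and the ambiguity is visible, not hidden.

Inputs consumed BY NAME: t8's `mem_GtpYdd_of_toTheta_mem` (`toTheta⁻¹ Δ_Θ ⊆ Π^tp_Ÿ ∩ Δ^tp_X`, under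
`Sec2Hyps`), `index_Huu` (`[Π^tp_X : Π^tp_{X̲̲}] = l²`), `Huu_le_GtpXu`; t1's `NonCuspidalPoint.aug_injOn`,
`.map_aug_Dpt`, `Sec2Hyps.GKdd_eq` (`K = K̈`, Def 2.5). DEFINITIONS + kernel-checked structural lemmas;
no instance, no notation, no new `Prop` fact; nothing is asserted about an actual curve (an inhabitant of
`OrbitEmbedding` is d3's `TemperedCoverData.ofSetting` row). HONEST FRAMING: [EtTh] is refereed; no side
is taken on [IUTchIII] Cor 3.12; typed ≠ endorsed.
-/

noncomputable section

namespace Literature.AnabelianGeometry.EtaleTheta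

open Literature.AnabelianGeometry.SemiGraphs ThetaCovers

universe u

namespace ThetaSetting.EtaleThetaData.DoubleUnderline

variable {p : ℕ} [Fact p.Prime] {D : ThetaSetting p} {E : D.EtaleThetaData} {l : ℕ}
  (C : E.DoubleUnderline l)

/-- **Parameter bundle**: how the §1 tempered group `Π^tp_X` (with the choice `X̲̲`) sits inside the
tempered `Π^tp_C = T.Gtp` of a `TemperedCoverData` — the identities abc-iut-L2-d3's
`TemperedCoverData.ofSetting` produces (`ι := inclX`, `T.PiYddtp := ι(Π^tp_Ÿ)`, `T`'s `Π^tp_{X̲̲} = ι(Π^tp_{X̲̲})`,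
normality in `Π^tp_C` of the `Δ_Θ`-subquotient data, `T.GK = G_K` compatibly with the augmentations) and
the two points `τ^{±1}` of Def 1.9 (p.29) at which standard sets of values are read.
[cite: MochizukiEtTh2009, Def 2.7 p.41] -/
structure OrbitEmbedding (T : TemperedCoverData.{u} l) : Type u where
  /-- `Π^tp_X ↪ Π^tp_C` ("`Π^tp_X ⊆ Π^tp_C`", p.36) -/
  ι : D.PiTemp →* T.Gtp
  /-- … injective -/
  injective_ι : Function.Injective ι
  /-- `Π^tp_Ÿ` of `T` is the image of `Π^tp_Ÿ` of the §1 setting -/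
  map_GtpYdd : D.GtpYdd.map ι = T.PiYddtp
  /-- `Π^tp_{X̲̲}` of `T` (pulled back to `Π^tp_C`) is the image of the chosen `Π^tp_{X̲̲} = C.Huu` -/
  map_Huu : C.Huu.map ι = T.tp T.PiXuu
  /-- the inverse image of `Δ_Θ ⊆ (Π^tp_X)^Θ` is normal in `Π^tp_C` (`Δ_Θ` is a characteristic
  subquotient; at d3's model: `ε`-invariance of `Δ^tp_X` and of `Ker toTheta`) -/
  normal_top : ((D.DeltaTheta.comap D.toTheta).map ι).Normal
  /-- `Ker(Π^tp_X ↠ (Π^tp_X)^Θ)` is normal in `Π^tp_C` -/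
  normal_bot : (D.toTheta.ker.map ι).Normal
  /-- `G_K` of the §1 setting IS the `G_K` of `T` … -/
  gk : ↥D.GK ≃* T.GK
  /-- … compatibly with the augmentations `Π^tp_X → G_K` and `Π^tp_C → Π_C → G_K` -/
  aug_ι : ∀ g : D.PiTemp, T.aug (T.toHat (ι g)) = gk ⟨D.aug g, D.aug_mem_GK g⟩
  /-- the point `τ` of `Ÿ` over the 4-torsion point determined by `√−1` (Def 1.9, p.29) -/
  tau : ThetaSetting.NonCuspidalPoint E.toKummerData
  /-- the point `τ⁻¹` (Def 1.9, p.29) -/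
  tauInv : ThetaSetting.NonCuspidalPoint E.toKummerData

namespace OrbitEmbedding

variable {C} {T : TemperedCoverData.{u} l} (ε : C.OrbitEmbedding T)

/-! ### The cyclotome `Δ_Θ` as a subquotient of `Π^tp_C` -/

/-- `top` = image in `Π^tp_C` of the inverse image `toTheta⁻¹(Δ_Θ) ⊆ Π^tp_X`.
[cite: MochizukiEtTh2009, Def 2.7 p.41] -/
def top : Subgroup T.Gtp := (D.DeltaTheta.comap D.toTheta).map ε.ι

/-- `bot` = image in `Π^tp_C` of `Ker(Π^tp_X ↠ (Π^tp_X)^Θ)`. [cite: MochizukiEtTh2009, Def 2.7 p.41] -/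
def bot : Subgroup T.Gtp := D.toTheta.ker.map ε.ι

/-- `bot ≤ top`. [cite: MochizukiEtTh2009, Def 2.7 p.41] -/
theorem bot_le_top : ε.bot ≤ ε.top :=
  Subgroup.map_mono fun g hg => by
    rw [Subgroup.mem_comap, (MonoidHom.mem_ker).1 hg]
    exact one_mem _

/-- The coefficient cyclotome `Δ_Θ = top/bot` of the orbit data (a type; its group structure comes from
`normal_bot`, cf. `ThetaOrbitData.DeltaTheta`). [cite: MochizukiEtTh2009, Def 2.7 p.41] -/
abbrev Coeff : Type u := ↥ε.top ⧸ ε.bot.subgroupOf ε.top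

/-- The composite augmentation `Π^tp_X → Π^tp_C → Π_C → T.GK` is `gk ∘ aug`.
[cite: MochizukiEtTh2009, Def 2.1 p.36] -/
theorem aug_toHat_ι (g : D.PiTemp) :
    (T.aug.comp T.toHat) (ε.ι g) = ε.gk ⟨D.aug g, D.aug_mem_GK g⟩ := ε.aug_ι g

/-- `top ⊆ Π^tp_Ÿ ∩ Δ` of `T`: `toTheta⁻¹(Δ_Θ) ⊆ Π^tp_Ÿ ∩ Δ^tp_X` (t8's `mem_GtpYdd_of_toTheta_mem`, which
uses `K = K̈`, Def 2.5 (i)). [cite: MochizukiEtTh2009, Def 2.7 p.41] -/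
theorem top_le (hS : D.Sec2Hyps) : ε.top ≤ T.PiYddtp ⊓ (T.aug.comp T.toHat).ker := by
  rintro _ ⟨g, hg, rfl⟩
  have hg' : D.toTheta g ∈ D.DeltaTheta := hg
  have h := EtaleThetaData.DoubleUnderline.mem_GtpYdd_of_toTheta_mem hS hg'
  refine Subgroup.mem_inf.2 ⟨ε.map_GtpYdd.le ⟨g, h.1, rfl⟩, MonoidHom.mem_ker.2 ?_⟩
  rw [ε.aug_toHat_ι]
  have h1 : (⟨D.aug g, D.aug_mem_GK g⟩ : ↥D.GK) = 1 :=
    Subtype.ext ((MonoidHom.mem_ker).1 (show g ∈ D.aug.toMonoidHom.ker from h.2))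
  rw [h1, map_one]

/-- A lift to `Π^tp_X` of an element of `Δ_Θ ⊆ (Π^tp_X)^Θ` (`toTheta` is surjective).
[cite: MochizukiEtTh2009, Def 2.7 p.41] -/
def lift (d : ↥D.DeltaTheta) : D.PiTemp := (D.toTheta_surjective (d : D.GtpTheta)).choose

/-- `toTheta (lift d) = d`. [cite: MochizukiEtTh2009, Def 2.7 p.41] -/
theorem toTheta_lift (d : ↥D.DeltaTheta) : D.toTheta (lift d) = d :=
  (D.toTheta_surjective (d : D.GtpTheta)).choose_spec

/-- `ι (lift d) ∈ top`. [cite: MochizukiEtTh2009, Def 2.7 p.41] -/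
theorem ι_lift_mem_top (d : ↥D.DeltaTheta) : ε.ι (lift d) ∈ ε.top :=
  Subgroup.mem_map.2 ⟨lift d, Subgroup.mem_comap.2 (by rw [toTheta_lift]; exact d.2), rfl⟩

/-- The comparison map `Δ_Θ → top/bot`, `d ↦ [ι(lift d)]` (independent of the lift modulo
`bot = ι(Ker toTheta)`). [cite: MochizukiEtTh2009, Def 2.7 p.41] -/
def coeffOf (d : ↥D.DeltaTheta) : ε.Coeff :=
  ((⟨ε.ι (lift d), ε.ι_lift_mem_top d⟩ : ↥ε.top) : ε.Coeff)

/-- Two elements of `top` with the same image under `toTheta ∘ ι⁻¹` define the same class in `top/bot`: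
for `g, g' ∈ toTheta⁻¹(Δ_Θ)` with `toTheta g = toTheta g'`, `[ι g] = [ι g']`.
[cite: MochizukiEtTh2009, Def 2.7 p.41] -/
theorem mk_eq_mk_of_toTheta_eq {g g' : D.PiTemp} (hg : ε.ι g ∈ ε.top) (hg' : ε.ι g' ∈ ε.top)
    (h : D.toTheta g = D.toTheta g') :
    ((⟨ε.ι g, hg⟩ : ↥ε.top) : ε.Coeff) = ((⟨ε.ι g', hg'⟩ : ↥ε.top) : ε.Coeff) := by
  rw [QuotientGroup.eq, Subgroup.mem_subgroupOf]
  change (ε.ι g)⁻¹ * ε.ι g' ∈ ε.bot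
  rw [← map_inv, ← map_mul]
  exact Subgroup.mem_map.2
    ⟨g⁻¹ * g', MonoidHom.mem_ker.2 (by rw [map_mul, map_inv, h, inv_mul_cancel]), rfl⟩

/-- `coeffOf d` is the class of ANY `ι g` with `toTheta g = d`. [cite: MochizukiEtTh2009, Def 2.7 p.41] -/
theorem coeffOf_eq_mk {d : ↥D.DeltaTheta} {g : D.PiTemp} (h : D.toTheta g = d) (hg : ε.ι g ∈ ε.top) :
    ε.coeffOf d = ((⟨ε.ι g, hg⟩ : ↥ε.top) : ε.Coeff) :=
  ε.mk_eq_mk_of_toTheta_eq _ _ (by rw [toTheta_lift, h])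

/-! ### Transport of cocycles and classes from `Π^tp_Ÿ ⊆ Π^tp_X` to `T.PiYddtp ⊆ Π^tp_C` -/

/-- The inverse of `ι` on `Π^tp_Ÿ`: `T.PiYddtp = ι(Π^tp_Ÿ)`. [cite: MochizukiEtTh2009, Def 2.7 p.41] -/
def pull (y : ↥T.PiYddtp) : ↥D.GtpYdd :=
  ⟨(Subgroup.mem_map.1 (ε.map_GtpYdd.ge y.2)).choose,
    (Subgroup.mem_map.1 (ε.map_GtpYdd.ge y.2)).choose_spec.1⟩

/-- `ι (pull y) = y`. [cite: MochizukiEtTh2009, Def 2.7 p.41] -/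
theorem ι_pull (y : ↥T.PiYddtp) : ε.ι (ε.pull y : D.PiTemp) = y :=
  (Subgroup.mem_map.1 (ε.map_GtpYdd.ge y.2)).choose_spec.2

/-- `pull (ι g) = g` for `g ∈ Π^tp_Ÿ` (`ι` injective). [cite: MochizukiEtTh2009, Def 2.7 p.41] -/
theorem pull_ι (g : ↥D.GtpYdd) : ε.pull ⟨ε.ι g, ε.map_GtpYdd.le ⟨g, g.2, rfl⟩⟩ = g :=
  Subtype.ext (ε.injective_ι (by rw [ι_pull]))

/-- Transport of a `Δ_Θ`-valued function on `Π^tp_Ÿ` to a `top/bot`-valued function on `T.PiYddtp`: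
`F(y) = [ι lift f(ι⁻¹ y)]`. [cite: MochizukiEtTh2009, Def 2.7 p.41] -/
def transport (f : ↥D.GtpYdd → ↥D.DeltaTheta) : ↥T.PiYddtp → ε.Coeff := fun y => ε.coeffOf (f (ε.pull y))

/-- A cohomology class `x ∈ H¹(Π^tp_Ÿ, Δ_Θ)` (abc-iut-L2-t1's `ContH1`) transported to `Π^tp_C`: the set
of transports of its (continuous) cocycle representatives. [cite: MochizukiEtTh2009, Def 2.7 p.41] -/
def classOf (x : D.H1 D.GtpYdd) : Set (↥T.PiYddtp → ε.Coeff) :=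
  {F | ∃ f : ↥(contCocycles D.toTheta D.DeltaTheta D.GtpYdd), ContH1.mk f.1 f.2 = x ∧ F = ε.transport f.1}

/-- The collection of transported classes of the `S`-conjugates `σ·η̈^Θ`, `σ ∈ S ⊆ Π^tp_X`, of the étale
theta class (`S = Π^tp_X`: `η̈^{Θ,ℤ×μ₂}`; `S = Π^tp_{X̲}`: `η̈^{Θ,l·ℤ×μ₂}`; `S = Π^tp_{X̲} ∩ ι⁻¹Π^tp_Ċ`:
`η̈^{Θ,l·ℤ}`). [cite: MochizukiEtTh2009, Def 2.7 p.41] -/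
def orbitColl (hC : D.Compat) (S : Set D.PiTemp) : Set (Set (↥T.PiYddtp → ε.Coeff)) :=
  haveI := hC.GtpYdd_normal
  {c | ∃ σ ∈ S, c = ε.classOf (ContH1.conj D.toTheta D.DeltaTheta σ E.etaDd)}

/-- `orbitColl` is monotone in the conjugating set. [cite: MochizukiEtTh2009, Def 2.7 p.41] -/
theorem orbitColl_mono (hC : D.Compat) {S S' : Set D.PiTemp} (h : S ⊆ S') :
    ε.orbitColl hC S ⊆ ε.orbitColl hC S' := by
  rintro c ⟨σ, hσ, rfl⟩
  exact ⟨σ, h hσ, rfl⟩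

/-- The class of `l`-th ROOTS on `Π^tp_{Ÿ̲̲} = T.PiYddtp ∩ Π^tp_{X̲̲}` of a class `x` on `Π^tp_Ÿ`: the functions
`ξ` with `ξ^l = F|_{Ÿ̲̲}` pointwise for some representative `F` of (the transport of) `x` ("`η̈^Θ` determines
`η̲̈^Θ ∈ H¹(Π^tp_{Ÿ̲̲}, l·Δ_Θ)`", p.41 — all `l`-th roots of all representatives are collected, cf. the module
docstring). [cite: MochizukiEtTh2009, Def 2.7 p.41] -/
def rootClassOf (x : D.H1 D.GtpYdd) : Set (↥(T.PiYddtp ⊓ T.tp T.PiXuu) → ε.Coeff) :=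
  haveI : ε.bot.Normal := ε.normal_bot
  {ξ | ∃ F ∈ ε.classOf x, ∀ g : ↥(T.PiYddtp ⊓ T.tp T.PiXuu), ξ g ^ l = F ⟨g, g.2.1⟩}

/-- The collection of root classes of the `S`-conjugates of `η̈^Θ` (`S = Π^tp_{X̲̲}`: `η̲̈^{Θ,l·ℤ×μ₂}`;
`S = Π^tp_{X̲̲} ∩ ι⁻¹Π^tp_Ċ`: `η̲̈^{Θ,l·ℤ}`). [cite: MochizukiEtTh2009, Def 2.7 p.41] -/
def rootColl (hC : D.Compat) (S : Set D.PiTemp) : Set (Set (↥(T.PiYddtp ⊓ T.tp T.PiXuu) → ε.Coeff)) :=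
  haveI := hC.GtpYdd_normal
  {c | ∃ σ ∈ S, c = ε.rootClassOf (ContH1.conj D.toTheta D.DeltaTheta σ E.etaDd)}

/-- `rootColl` is monotone in the conjugating set. [cite: MochizukiEtTh2009, Def 2.7 p.41] -/
theorem rootColl_mono (hC : D.Compat) {S S' : Set D.PiTemp} (h : S ⊆ S') :
    ε.rootColl hC S ⊆ ε.rootColl hC S' := by
  rintro c ⟨σ, hσ, rfl⟩
  exact ⟨σ, h hσ, rfl⟩

/-- `Π^tp_{Ẋ̲} ∩ Π^tp_X`, read through `ι` from `T`'s dotted group `Π^tp_Ċ`: the elements of `Π^tp_{X̲}`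
mapping into `Π^tp_Ċ`. [cite: MochizukiEtTh2009, Def 2.7 p.41] -/
def dotXu : Set D.PiTemp := {σ | σ ∈ D.GtpXu l ∧ ε.ι σ ∈ T.PiCdot}

/-- `Π^tp_{Ẋ̲̲} ∩ Π^tp_X`: the elements of `Π^tp_{X̲̲}` mapping into `Π^tp_Ċ`. [cite: MochizukiEtTh2009, Def 2.7 p.41] -/
def dotXuu : Set D.PiTemp := {σ | σ ∈ C.Huu ∧ ε.ι σ ∈ T.PiCdot}

/-! ### The decomposition groups over `τ^{±1}` -/

/-- The decomposition group in `Π^tp_{Ÿ̲̲}` of (a point of `Ÿ̲̲` over) a non-cuspidal point `y` of `Ÿ`, in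
`Π^tp_C`: `ι(D_y ∩ Π^tp_{X̲̲})`. [cite: MochizukiEtTh2009, Def 1.9 p.29] -/
def decompUU (y : ThetaSetting.NonCuspidalPoint E.toKummerData) : Subgroup T.Gtp :=
  (y.Dpt ⊓ C.Huu).map ε.ι

/-- `ι(D_y ∩ Π^tp_{X̲̲}) ⊆ Π^tp_{Ÿ̲̲}` of `T`. [cite: MochizukiEtTh2009, Def 1.9 p.29] -/
theorem decompUU_le (y : ThetaSetting.NonCuspidalPoint E.toKummerData) :
    ε.decompUU y ≤ T.PiYddtp ⊓ T.tp T.PiXuu := by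
  rintro _ ⟨g, hg, rfl⟩
  exact ⟨ε.map_GtpYdd.le ⟨g, y.Dpt_le hg.1, rfl⟩, ε.map_Huu.le ⟨g, hg.2, rfl⟩⟩

/-- The composite augmentation is injective on `ι(D_y ∩ Π^tp_{X̲̲})` (`D_y ↪ G_K` for a rational
non-cuspidal point). [cite: MochizukiEtTh2009, Def 1.9 p.29] -/
theorem injOn_decompUU (y : ThetaSetting.NonCuspidalPoint E.toKummerData) :
    Set.InjOn (T.aug.comp T.toHat) (ε.decompUU y) := by
  rintro _ ⟨g, hg, rfl⟩ _ ⟨g', hg', rfl⟩ h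
  rw [SetLike.mem_coe] at hg hg'
  rw [ε.aug_toHat_ι, ε.aug_toHat_ι] at h
  have h' : D.aug g = D.aug g' := congrArg Subtype.val (ε.gk.injective h)
  rw [y.aug_injOn hg.1 hg'.1 h']

/-- `[Π^tp_X : Π^tp_{X̲̲}] = l²` is finite (`l` odd). [cite: MochizukiEtTh2009, Rmk 2.3.1 p.38] -/
theorem _root_.Literature.AnabelianGeometry.EtaleTheta.ThetaSetting.EtaleThetaData.DoubleUnderline.finiteIndex_Huu
    (C : E.DoubleUnderline l) : C.Huu.FiniteIndex := by
  refine ⟨?_⟩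
  rw [C.index_Huu]
  obtain ⟨k, hk⟩ := C.l_odd
  exact pow_ne_zero _ (by omega)

/-- The image of `ι(D_y ∩ Π^tp_{X̲̲})` in `T.GK` has finite index: `D_y ↠ G_{K̈} = G_K` (`K = K̈`, Def 2.5)
and `[D_y : D_y ∩ Π^tp_{X̲̲}] ≤ l²`. [cite: MochizukiEtTh2009, Def 1.9 p.29] -/
theorem finiteIndex_map_decompUU (hS : D.Sec2Hyps) (y : ThetaSetting.NonCuspidalPoint E.toKummerData) :
    ((ε.decompUU y).map (T.aug.comp T.toHat)).FiniteIndex := by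
  haveI := C.finiteIndex_Huu
  -- rewrite as the image of `Π^tp_{X̲̲} ∩ D_y ⊆ D_y` under `ψ : D_y → T.GK`
  let ψ : ↥y.Dpt →* T.GK := (T.aug.comp T.toHat).comp (ε.ι.comp y.Dpt.subtype)
  have hEq : (ε.decompUU y).map (T.aug.comp T.toHat) = (C.Huu.subgroupOf y.Dpt).map ψ := by
    rw [decompUU, Subgroup.map_map, inf_comm, ← Subgroup.subgroupOf_map_subtype, Subgroup.map_map]
    rfl
  rw [hEq]
  refine ⟨?_⟩
  rw [Subgroup.index_map]
  refine mul_ne_zero (Subgroup.finiteIndex_of_le (K := C.Huu.subgroupOf y.Dpt ⊔ ψ.ker)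
    le_sup_left).index_ne_zero ?_
  -- `ψ` is onto `T.GK`
  have hr : ψ.range = ⊤ := by
    rw [eq_top_iff]
    rintro t -
    obtain ⟨γ, hγ⟩ : ∃ γ : ↥D.GK, ε.gk γ = t := ε.gk.surjective t
    have hγ' : (γ : GQp p) ∈ y.Dpt.map D.aug.toMonoidHom := by
      rw [y.map_aug_Dpt]
      have h2 : D.GKN 2 = D.GK := hS.GKdd_eq
      change (γ : GQp p) ∈ D.GKN 2
      rw [h2]; exact γ.2
    obtain ⟨g, hg, hgγ⟩ := hγ'
    refine ⟨⟨g, hg⟩, ?_⟩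
    change (T.aug.comp T.toHat) (ε.ι g) = t
    rw [ε.aug_toHat_ι, ← hγ]
    congr 1
    exact Subtype.ext hgγ
  rw [hr, Subgroup.index_top]
  exact one_ne_zero

end OrbitEmbedding

end ThetaSetting.EtaleThetaData.DoubleUnderline

/-! ## The constructor -/

namespace ThetaCovers.ThetaOrbitData

variable {p : ℕ} [Fact p.Prime] {D : ThetaSetting p} {E : D.EtaleThetaData} {l : ℕ}
  {C : E.DoubleUnderline l} {T : TemperedCoverData.{u} l}

/-- **`ThetaOrbitData` at the §1 model** (Def 2.7, pp.40–41), along an `OrbitEmbedding` of the §1 tempered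
group into `Π^tp_C = T.Gtp`, under the §1 compatibility `Compat` (normality of `Π^tp_Ÿ`, so that `Π^tp_X`
acts on `H¹(Π^tp_Ÿ, Δ_Θ)`) and `Sec2Hyps` (`K = K̈`, Def 2.5 (i)): cyclotome `ι(toTheta⁻¹Δ_Θ)/ι(Ker toTheta)`;
`Dtau = {ι(D_τ ∩ Π^tp_{X̲̲}), ι(D_{τ⁻¹} ∩ Π^tp_{X̲̲})}`; `η̈^{Θ,ℤ×μ₂}, η̈^{Θ,l·ℤ×μ₂}, η̈^{Θ,l·ℤ}` the transported
`Π^tp_X`-, `Π^tp_{X̲}`-, `(Π^tp_{X̲} ∩ ι⁻¹Π^tp_Ċ)`-orbits of `η̈^Θ`; `η̲̈^{Θ,l·ℤ×μ₂}, η̲̈^{Θ,l·ℤ}` the root classes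
of the `Π^tp_{X̲̲}`-, `(Π^tp_{X̲̲} ∩ ι⁻¹Π^tp_Ċ)`-orbits. [cite: MochizukiEtTh2009, Def 2.7 p.41] -/
def ofEmbedding (ε : C.OrbitEmbedding T) (hC : D.Compat) (hS : D.Sec2Hyps) : ThetaOrbitData T where
  top := ε.top
  bot := ε.bot
  bot_le := ε.bot_le_top
  top_normal := ε.normal_top
  bot_normal := ε.normal_bot
  top_le := ε.top_le hS
  Dtau := {ε.decompUU ε.tau, ε.decompUU ε.tauInv}
  Dtau_le := by
    rintro S (rfl | rfl)
    · exact ε.decompUU_le ε.tau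
    · exact ε.decompUU_le ε.tauInv
  Dtau_nonempty := ⟨_, Or.inl rfl⟩
  Dtau_aug := by
    rintro S (rfl | rfl)
    · exact ⟨ε.injOn_decompUU ε.tau, ε.finiteIndex_map_decompUU hS ε.tau⟩
    · exact ⟨ε.injOn_decompUU ε.tauInv, ε.finiteIndex_map_decompUU hS ε.tauInv⟩
  etaZMu2 := ε.orbitColl hC Set.univ
  etaLZMu2 := ε.orbitColl hC (D.GtpXu l)
  etaLZ := ε.orbitColl hC ε.dotXu
  etaLZ_sub := ⟨ε.orbitColl_mono hC fun _ h => h.1, ε.orbitColl_mono hC (Set.subset_univ _)⟩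
  rootLZMu2 := ε.rootColl hC C.Huu
  rootLZ := ε.rootColl hC ε.dotXuu
  rootLZ_sub := ε.rootColl_mono hC fun _ h => h.1
  root_pow := by
    rintro c ⟨σ, hσ, rfl⟩ ξ ⟨F, hF, hpow⟩
    exact ⟨ε.classOf _, ⟨σ, C.Huu_le_GtpXu hσ, rfl⟩, F, hF, hpow⟩

/-- The cyclotome of `ofEmbedding` is `top/bot = ι(toTheta⁻¹Δ_Θ)/ι(Ker toTheta)` (by `rfl`).
[cite: MochizukiEtTh2009, Def 2.7 p.41] -/
theorem ofEmbedding_top (ε : C.OrbitEmbedding T) (hC : D.Compat) (hS : D.Sec2Hyps) :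
    (ofEmbedding ε hC hS).top = ε.top ∧ (ofEmbedding ε hC hS).bot = ε.bot := ⟨rfl, rfl⟩

/-- The orbit collections of `ofEmbedding`, unfolded (by `rfl`). [cite: MochizukiEtTh2009, Def 2.7 p.41] -/
theorem ofEmbedding_colls (ε : C.OrbitEmbedding T) (hC : D.Compat) (hS : D.Sec2Hyps) :
    (ofEmbedding ε hC hS).etaZMu2 = ε.orbitColl hC Set.univ ∧
    (ofEmbedding ε hC hS).etaLZMu2 = ε.orbitColl hC (D.GtpXu l) ∧
    (ofEmbedding ε hC hS).etaLZ = ε.orbitColl hC ε.dotXu ∧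
    (ofEmbedding ε hC hS).rootLZMu2 = ε.rootColl hC C.Huu ∧
    (ofEmbedding ε hC hS).rootLZ = ε.rootColl hC ε.dotXuu := ⟨rfl, rfl, rfl, rfl, rfl⟩

/-- The `Dtau` of `ofEmbedding` (by `rfl`). [cite: MochizukiEtTh2009, Def 1.9 p.29] -/
theorem ofEmbedding_Dtau (ε : C.OrbitEmbedding T) (hC : D.Compat) (hS : D.Sec2Hyps) :
    (ofEmbedding ε hC hS).Dtau = {ε.decompUU ε.tau, ε.decompUU ε.tauInv} := rfl

end ThetaCovers.ThetaOrbitData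

end Literature.AnabelianGeometry.EtaleTheta

end
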